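import Literature.MathematicalPhysics.QuantumFieldTheory.Balaban1983to89.B15TreeGauge196
import Literature.MathematicalPhysics.QuantumFieldTheory.Balaban1983to89.B15TreeGraph196

/-!
# `Balaban1983to89.B15TreeGauge196Bridge` — [Balaban1989LargeFieldI] p. 196: the DICTIONARY between the two typings of
# the contours `Γ_{y,x}` of the generalized axial gauge — the lattice WORDS of `B15TreeGauge196` (seat p26) and the unit-bond
# FINSETS of `B15TreeGraph196` (seat r12) — PROVED: the set of unit bonds traversed by the word `Γ_{y,x}` is the bond set
# `Γ_{y,x}`, for both the usual contour and the detour (row `B15.Def@196`)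

statement-level skeleton of published theorems with citation tags; proofs where landed; nothing here is a claim about
the Yang–Mills mass gap.

P. 196, verbatim: *"If x₁ ≦ a, then we take the usual contour Γ_{y,x} = [y,(y₁,…,y_{d−1},x_d)] ∪ ⋯ ∪ [(y₁,x₂,…,x_d), x].
If x₁ > a, then we take the contour Γ_{y,x} = [y,(y₁,…,y_{d−1},x_d)] ∪ ⋯ ∪ [(y₁,y₂,y₃,x₄,…,x_d),(y₁,y₂,x₃,x₄,…,x_d)] ∪
[(y₁,y₂,x₃,…,x_d),(b₁ − 1/2,y₂,x₃,…,x_d)] ∪ [(b₁ − 1/2,y₂,x₃,…,x_d),(b₁ − 1/2,x₂,x₃,…,x_d)] ∪ [(b₁ − 1/2,x₂,x₃,…,x_d), x].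
… The union of all the contours is a tree graph T on P₁∖P₂"*.

THE TWO TYPINGS.  `B15TreeGauge196.contour lo hi τ x : List (Letter (n + 3))` spells `Γ_{y,x}` as a word from the corner
`y = lo` (`treeWord (x − lo)` if `x i0 ≤ τ`, else `tw (highDirs n) (x − lo) ++ detourTail lo hi x`) — the reading used for
the gauge transformation `v(x) = V(Γ_{y,x})` and the Stokes estimates of [Balaban1989LargeFieldII] p. 382.
`B15TreeGraph196.contour l u a x : Finset (LBond _)` lists the unit bonds `⟨w, w + e_μ⟩ = (w, μ)` of `Γ_{y,x}` by a
coordinate description (`usual`, `detour`) — the reading in which *"the union of all the contours is a tree graph"* is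
PROVED (`tree_isTree`, `card_tree`).  This file proves they describe THE SAME OBJECT: `wordBonds lo Γ` (the unit bonds
traversed by a word: a forward letter `+e_μ` at `w` traverses `(w, μ)`, a backward letter `−e_μ` at `w` traverses
`(w − e_μ, μ)`) of p26's word equals r12's bond set (`wordBonds_contour`), for every lattice point `x` of the box
`lo ≤ x ≤ hi` (the lattice dimension is `d = n + 3`, r12's carrier `LPt (n + 1) = Fin (n + 3) → ℤ`).  Consequently the
union of p26's contours over `P₁∖P₂` is r12's tree `T` (`biUnion_wordBonds_contour`), to which `tree_isTree` and
`card_tree` apply (`wordContours_isTree`) — the tree PROPERTY that `B15TreeGauge196` (honest scope: *"not the tree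
property itself"*) and `B15TreeGauge196Annulus` (the contours stay in `P₁∖P₂`) leave to this dictionary.

CONTENTS.  §1 `wordBonds` and its calculus (append, straight segments of both signs, monotone multi-segment words over a
decreasing list of directions); §2 the usual contour; §3 the detour; §4 the contour and the tree.  All PROVED; no
`def … : Prop`.
-/

noncomputable section

namespace Literature.MathematicalPhysics.QuantumFieldTheory.Balaban1983to89.B15TreeGauge196Bridge

open B7Prop1Explicit (Letter e e_apply disp disp_nil disp_cons disp_append seg seg_natCast seg_zero seg_neg_natCast disp_seg
  treeWord)
open B8Lemma1NonAbelian (tw tw_nil tw_cons zsmul_e_apply treeWord_eq_tw pairwise_gt_finRange_reverse)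
open B15TreeGauge196 (restrict restrict_nil restrict_cons restrict_apply_of_mem restrict_apply_of_not_mem disp_tw i0 i1
  i0_val i1_val highDirs mem_highDirs highDirs_nodup finRange_reverse_eq detourTail contour_of_le contour_of_not_le)
open B15TreeGraph196 (LPt LBond box mem_box usual mem_usual detour mem_detour)

/-! ## §1  The unit bonds traversed by a lattice word -/

section WordBonds

variable {d : ℕ}

/-- The unit bond traversed by the letter `l` read at the point `x`: `(x, μ)` for `+e_μ`, `(x − e_μ, μ)` for `−e_μ`
(bonds recorded as (lower end point, direction), the convention of `B6BondElimination`/`B15TreeGraph196`).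
[cite: Balaban1989LargeFieldI, p.196] -/
def bondOf (x : Fin d → ℤ) (l : Letter d) : (Fin d → ℤ) × Fin d := if l.2 then (x, l.1) else (x + l.vec, l.1)

/-- THE SET OF UNIT BONDS TRAVERSED by the word `w` spelled from `x`. [cite: Balaban1989LargeFieldI, p.196] -/
def wordBonds : (Fin d → ℤ) → List (Letter d) → Finset ((Fin d → ℤ) × Fin d)
  | _, [] => ∅
  | x, l :: w => insert (bondOf x l) (wordBonds (x + l.vec) w)

/-- `wordBonds` of the empty word. [cite: Balaban1989LargeFieldI, p.196] -/
@[simp] theorem wordBonds_nil (x : Fin d → ℤ) : wordBonds x [] = ∅ := rfl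

/-- `wordBonds` of a cons. [cite: Balaban1989LargeFieldI, p.196] -/
theorem wordBonds_cons (x : Fin d → ℤ) (l : Letter d) (w : List (Letter d)) :
    wordBonds x (l :: w) = insert (bondOf x l) (wordBonds (x + l.vec) w) := rfl

/-- The bonds of a concatenation: those of the first word and those of the second word read from where the first ends.
[cite: Balaban1989LargeFieldI, p.196] -/
theorem wordBonds_append (x : Fin d → ℤ) (w₁ w₂ : List (Letter d)) :
    wordBonds x (w₁ ++ w₂) = wordBonds x w₁ ∪ wordBonds (x + disp w₁) w₂ := by
  induction w₁ generalizing x with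
  | nil => simp
  | cons l w ih => rw [List.cons_append, wordBonds_cons, wordBonds_cons, ih, disp_cons, Finset.insert_union, add_assoc]

/-- The bond of a forward letter. [folklore] -/
private theorem bondOf_true (x : Fin d → ℤ) (κ : Fin d) : bondOf x (κ, true) = (x, κ) := by simp [bondOf]

/-- The bond of a backward letter. [folklore] -/
private theorem bondOf_false (x : Fin d → ℤ) (κ : Fin d) : bondOf x (κ, false) = (x - e κ, κ) := by
  simp [bondOf, Letter.vec, sub_eq_add_neg]

/-- The bonds of a FORWARD segment `[x, x + m e_κ]`: `(x + t e_κ, κ)`, `0 ≤ t < m`. [cite: Balaban1989LargeFieldI, p.196] -/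
theorem mem_wordBonds_seg_natCast {x : Fin d → ℤ} {κ : Fin d} {m : ℕ} {b : (Fin d → ℤ) × Fin d} :
    b ∈ wordBonds x (seg κ (m : ℤ)) ↔ ∃ t : ℕ, t < m ∧ b = (x + (t : ℤ) • e κ, κ) := by
  induction m generalizing x with
  | zero => simp
  | succ m ih =>
    rw [seg_natCast, List.replicate_succ, ← seg_natCast, wordBonds_cons, Finset.mem_insert, bondOf_true, Letter.vec_true, ih]
    constructor
    · rintro (rfl | ⟨t, ht, rfl⟩)
      · exact ⟨0, by omega, by simp⟩
      · refine ⟨t + 1, by omega, ?_⟩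
        rw [show ((t + 1 : ℕ) : ℤ) • e κ = e κ + (t : ℤ) • e κ by push_cast; rw [add_smul, one_smul, add_comm],
          add_assoc]
    · rintro ⟨t, ht, rfl⟩
      rcases t with _ | t
      · exact Or.inl (by simp)
      · refine Or.inr ⟨t, by omega, ?_⟩
        rw [show ((t + 1 : ℕ) : ℤ) • e κ = e κ + (t : ℤ) • e κ by push_cast; rw [add_smul, one_smul, add_comm],
          add_assoc]

/-- The bonds of a BACKWARD segment `[x, x − m e_κ]`: `(x − (t + 1) e_κ, κ)`, `0 ≤ t < m`. [cite: Balaban1989LargeFieldI, p.196] -/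
theorem mem_wordBonds_seg_neg {x : Fin d → ℤ} {κ : Fin d} {m : ℕ} {b : (Fin d → ℤ) × Fin d} :
    b ∈ wordBonds x (seg κ (-(m : ℤ))) ↔ ∃ t : ℕ, t < m ∧ b = (x - ((t : ℤ) + 1) • e κ, κ) := by
  induction m generalizing x with
  | zero => simp
  | succ m ih =>
    rw [seg_neg_natCast, List.replicate_succ, ← seg_neg_natCast, wordBonds_cons, Finset.mem_insert, bondOf_false,
      Letter.vec_false, ih]
    constructor
    · rintro (rfl | ⟨t, ht, rfl⟩)
      · exact ⟨0, by omega, by simp⟩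
      · refine ⟨t + 1, by omega, ?_⟩
        rw [show x + -e κ - ((t : ℤ) + 1) • e κ = x - (((t + 1 : ℕ) : ℤ) + 1) • e κ by
          push_cast; simp only [add_smul, one_smul]; abel]
    · rintro ⟨t, ht, rfl⟩
      rcases t with _ | t
      · exact Or.inl (by simp [sub_eq_add_neg])
      · refine Or.inr ⟨t, by omega, ?_⟩
        rw [show x + -e κ - ((t : ℤ) + 1) • e κ = x - (((t + 1 : ℕ) : ℤ) + 1) • e κ by
          push_cast; simp only [add_smul, one_smul]; abel]

/-- THE BONDS OF A MONOTONE MULTI-SEGMENT WORD over a strictly DECREASING list of directions (the order `d, d−1, …` of the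
printed contours): the bonds of direction `κ ∈ ks` sit at the base point `x + (the coordinates of v listed before κ, i.e.
those of index > κ)` plus `t e_κ`, `0 ≤ t < v_κ`. [cite: Balaban1989LargeFieldI, p.196] -/
theorem mem_wordBonds_tw {ks : List (Fin d)} (hks : ks.Pairwise (fun a b => b < a)) {v : Fin d → ℤ}
    (hv : ∀ κ ∈ ks, 0 ≤ v κ) {x : Fin d → ℤ} {b : (Fin d → ℤ) × Fin d} :
    b ∈ wordBonds x (tw ks v) ↔
      ∃ κ ∈ ks, ∃ t : ℕ, (t : ℤ) < v κ ∧ b = (x + restrict (ks.filter fun i => κ < i) v + (t : ℤ) • e κ, κ) := by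
  induction ks generalizing x with
  | nil => simp
  | cons κ₀ ks ih =>
    rw [List.pairwise_cons] at hks
    obtain ⟨hκ₀, hks'⟩ := hks
    have hκ₀ks : κ₀ ∉ ks := fun h => lt_irrefl _ (hκ₀ κ₀ h)
    obtain ⟨m, hm⟩ := Int.eq_ofNat_of_zero_le (hv κ₀ (by simp))
    have hfilter0 : (κ₀ :: ks).filter (fun i => κ₀ < i) = [] := by
      rw [List.filter_eq_nil_iff]
      intro a ha
      rcases List.mem_cons.1 ha with rfl | ha
      · simp
      · have := hκ₀ a ha; simp only [decide_eq_true_eq, not_lt]; exact this.le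
    have hfilter : ∀ κ ∈ ks, (κ₀ :: ks).filter (fun i => κ < i) = κ₀ :: ks.filter (fun i => κ < i) := fun κ hκ => by
      rw [List.filter_cons, if_pos (by simpa using hκ₀ κ hκ)]
    rw [tw_cons, wordBonds_append, Finset.mem_union, hm, mem_wordBonds_seg_natCast, disp_seg,
      ih hks' (fun κ hκ => hv κ (by simp [hκ]))]
    constructor
    · rintro (⟨t, ht, rfl⟩ | ⟨κ, hκ, t, ht, rfl⟩)
      · refine ⟨κ₀, by simp, t, by omega, ?_⟩
        rw [hfilter0, restrict_nil, add_zero]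
      · refine ⟨κ, by simp [hκ], t, ht, ?_⟩
        have hκ₀F : κ₀ ∉ ks.filter (fun i => κ < i) := fun h => hκ₀ks (List.mem_filter.1 h).1
        rw [hfilter κ hκ, restrict_cons hκ₀F, hm, ← add_assoc]
    · rintro ⟨κ, hκ, t, ht, rfl⟩
      rcases List.mem_cons.1 hκ with rfl | hκ
      · refine Or.inl ⟨t, by omega, ?_⟩
        rw [hfilter0, restrict_nil, add_zero]
      · refine Or.inr ⟨κ, hκ, t, ht, ?_⟩
        have hκ₀F : κ₀ ∉ ks.filter (fun i => κ < i) := fun h => hκ₀ks (List.mem_filter.1 h).1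
        rw [hfilter κ hκ, restrict_cons hκ₀F, hm, ← add_assoc]

/-- The coordinates of `v` of index `> κ` (those already walked when the decreasing-order word reaches direction `κ`).
[cite: Balaban1989LargeFieldI, p.196] -/
def hiPart (κ : Fin d) (v : Fin d → ℤ) : Fin d → ℤ := fun i => if κ < i then v i else 0

/-- For the full decreasing list `d−1, …, 0` the listed-before-`κ` part of `v` is `hiPart κ v`. [cite: Balaban1989LargeFieldI, p.196] -/
theorem restrict_filter_finRange_reverse (κ : Fin d) (v : Fin d → ℤ) :
    restrict ((List.finRange d).reverse.filter fun i => κ < i) v = hiPart κ v := by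
  funext i
  by_cases h : κ < i
  · rw [restrict_apply_of_mem (List.mem_filter.2 ⟨by simp, by simpa using h⟩)]; simp [hiPart, h]
  · rw [restrict_apply_of_not_mem (fun hm => h (by simpa using (List.mem_filter.1 hm).2))]; simp [hiPart, h]

end WordBonds

/-! ## §2  The usual contour: `wordBonds y (treeWord (x − y)) = usual y x` -/

section Usual

variable {d : ℕ}

/-- The generic point of the usual contour's segment of direction `κ`: coordinates `x_i` above `κ`, `l_κ + t` at `κ`,
`l_i` below. [cite: Balaban1989LargeFieldI, p.196] -/
theorem usualPt_apply (l x : Fin d → ℤ) (κ : Fin d) (t : ℤ) (i : Fin d) :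
    (l + hiPart κ (x - l) + t • e κ) i = if κ < i then x i else if i = κ then l κ + t else l i := by
  simp only [Pi.add_apply, Pi.sub_apply, hiPart, zsmul_e_apply]
  by_cases h1 : κ < i
  · have h2 : i ≠ κ := fun h => by rw [h] at h1; exact lt_irrefl _ h1
    simp [h1, h2]
  · by_cases h2 : i = κ
    · subst h2; simp
    · simp [h1, h2]

end Usual

section UsualBridge

variable {n : ℕ}

/-- **THE USUAL CONTOUR, BOTH READINGS AGREE**: for `y = l ≤ x`, the unit bonds traversed by the word `treeWord (x − l)`
(B5 (1.7): coordinates changed in the order `d, d−1, …, 1`) read from `l` are exactly r12's `usual l x`.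
[cite: Balaban1989LargeFieldI, p.196] -/
theorem wordBonds_treeWord {l x : Fin (n + 2) → ℤ} (hlx : l ≤ x) :
    wordBonds l (treeWord (x - l)) = usual (n := n) l x := by
  have hv : ∀ κ ∈ (List.finRange (n + 2)).reverse, 0 ≤ (x - l) κ := fun κ _ => by
    have := hlx κ; simp only [Pi.sub_apply]; linarith
  ext b
  rw [treeWord_eq_tw, mem_wordBonds_tw (pairwise_gt_finRange_reverse (n + 2)) hv, mem_usual]
  constructor
  · rintro ⟨κ, -, t, ht, rfl⟩
    rw [restrict_filter_finRange_reverse]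
    have htκ : (t : ℤ) < x κ - l κ := by simpa only [Pi.sub_apply] using ht
    dsimp only
    refine ⟨mem_box.2 fun i => ?_, fun i hi => ?_, fun i hi => ?_, ?_⟩
    · rw [usualPt_apply]
      have h1 : l i ≤ x i := hlx i
      split_ifs with h2 h3
      · exact ⟨h1, le_rfl⟩
      · subst h3; constructor <;> omega
      · exact ⟨le_rfl, h1⟩
    · rw [usualPt_apply, if_neg (not_lt.2 hi.le), if_neg hi.ne]
    · rw [usualPt_apply, if_pos hi]
    · show (l + hiPart κ (x - l) + (t : ℤ) • e κ) κ < x κ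
      rw [usualPt_apply, if_neg (lt_irrefl κ), if_pos rfl]; omega
  · rintro ⟨hbox, hlow, hhigh, hlt⟩
    obtain ⟨w, κ⟩ := b
    simp only at hbox hlow hhigh hlt
    have hwκ : l κ ≤ w κ := ((mem_box.1 hbox) κ).1
    obtain ⟨t, ht⟩ := Int.eq_ofNat_of_zero_le (sub_nonneg.2 hwκ)
    refine ⟨κ, by simp, t, ?_, ?_⟩
    · simp only [Pi.sub_apply]; omega
    · rw [restrict_filter_finRange_reverse]
      refine Prod.ext (funext fun i => ?_) rfl
      show w i = (l + hiPart κ (x - l) + (t : ℤ) • e κ) i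
      rw [usualPt_apply]
      split_ifs with h1 h2
      · exact hhigh i h1
      · subst h2; omega
      · exact hlow i (lt_of_le_of_ne (not_lt.1 h1) h2)

end UsualBridge

/-! ## §3  The detour: `wordBonds y (tw highDirs (x − y) ++ detourTail y u x) = detour y u x` -/

section DetourBridge

variable {n : ℕ}

/-- `highDirs` is strictly decreasing. [cite: Balaban1989LargeFieldI, p.196] -/
theorem highDirs_pairwise : (highDirs n).Pairwise (fun a b => b < a) :=
  (finRange_reverse_eq (n := n) ▸ pairwise_gt_finRange_reverse (n + 3)).sublist (List.sublist_append_left _ _)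

/-- For `κ` a high direction, the listed-before-`κ` part of `v` along `highDirs` is again `hiPart κ v`.
[cite: Balaban1989LargeFieldI, p.196] -/
theorem restrict_filter_highDirs {κ : Fin (n + 3)} (hκ : κ ∈ highDirs n) (v : Fin (n + 3) → ℤ) :
    restrict ((highDirs n).filter fun i => κ < i) v = hiPart κ v := by
  rw [mem_highDirs] at hκ
  funext i
  by_cases h : κ < i
  · have hi : i ∈ highDirs n := mem_highDirs.2 (by have := Fin.lt_def.1 h; omega)
    rw [restrict_apply_of_mem (List.mem_filter.2 ⟨hi, by simpa using h⟩)]; simp [hiPart, h]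
  · rw [restrict_apply_of_not_mem (fun hm => h (by simpa using (List.mem_filter.1 hm).2))]; simp [hiPart, h]

/-- The whole `highDirs` part of `v`: the coordinates of index `≥ 2`. [cite: Balaban1989LargeFieldI, p.196] -/
theorem restrict_highDirs_apply (v : Fin (n + 3) → ℤ) (i : Fin (n + 3)) :
    restrict (highDirs n) v i = if 2 ≤ i.val then v i else 0 := by
  by_cases h : 2 ≤ i.val
  · rw [restrict_apply_of_mem (mem_highDirs.2 h), if_pos h]
  · rw [restrict_apply_of_not_mem (fun hm => h (mem_highDirs.1 hm)), if_neg h]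

/-- The base point `p₁ = (y₁, y₂, x₃, …, x_d)` of the detour tail (after the high directions). [cite: Balaban1989LargeFieldI, p.196] -/
def P1 (l x : Fin (n + 3) → ℤ) : Fin (n + 3) → ℤ := fun i => if 2 ≤ i.val then x i else l i

/-- The corner `p₂ = (b₁ − 1/2, y₂, x₃, …)` on the far face. [cite: Balaban1989LargeFieldI, p.196] -/
def P2 (l u x : Fin (n + 3) → ℤ) : Fin (n + 3) → ℤ := fun i => if 2 ≤ i.val then x i else if i.val = 0 then u i else l i

/-- The corner `p₃ = (b₁ − 1/2, x₂, x₃, …)` on the far face. [cite: Balaban1989LargeFieldI, p.196] -/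
def P3 (u x : Fin (n + 3) → ℤ) : Fin (n + 3) → ℤ := fun i => if i.val = 0 then u i else x i

/-- Coordinates of `p₁`. [folklore] -/
private theorem P1_apply (l x : Fin (n + 3) → ℤ) (i : Fin (n + 3)) : P1 l x i = if 2 ≤ i.val then x i else l i := rfl

/-- Coordinates of `p₂`. [folklore] -/
private theorem P2_apply (l u x : Fin (n + 3) → ℤ) (i : Fin (n + 3)) :
    P2 l u x i = if 2 ≤ i.val then x i else if i.val = 0 then u i else l i := rfl

/-- Coordinates of `p₃`. [folklore] -/
private theorem P3_apply (u x : Fin (n + 3) → ℤ) (i : Fin (n + 3)) : P3 u x i = if i.val = 0 then u i else x i := rfl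

/-- `i = i0 ↔ i.val = 0`. [folklore] -/
private theorem eq_i0_iff (i : Fin (n + 3)) : i = i0 ↔ i.val = 0 := by rw [Fin.ext_iff, i0_val]

/-- `i = i1 ↔ i.val = 1`. [folklore] -/
private theorem eq_i1_iff (i : Fin (n + 3)) : i = i1 ↔ i.val = 1 := by rw [Fin.ext_iff, i1_val]

/-- `y + (the high coordinates of x − y) = p₁`. [cite: Balaban1989LargeFieldI, p.196] -/
theorem base1_eq (l x : Fin (n + 3) → ℤ) : l + restrict (highDirs n) (x - l) = P1 l x := by
  funext i
  rw [Pi.add_apply, restrict_highDirs_apply, Pi.sub_apply, P1_apply]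
  split_ifs <;> ring

/-- `p₁ + (b₁ − 1/2 − y₁)e₁ = p₂`. [cite: Balaban1989LargeFieldI, p.196] -/
theorem base2_eq (l u x : Fin (n + 3) → ℤ) : P1 l x + (u i0 - l i0) • e (i0 : Fin (n + 3)) = P2 l u x := by
  funext i
  rw [Pi.add_apply, zsmul_e_apply, P1_apply, P2_apply]
  by_cases hz : i.val = 0
  · have hi : i = i0 := (eq_i0_iff i).2 hz
    subst hi
    rw [if_pos rfl, if_neg (by rw [i0_val]; omega), if_neg (by rw [i0_val]; omega), if_pos i0_val]
    ring
  · have hi : i ≠ i0 := fun h => hz ((eq_i0_iff i).1 h)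
    rw [if_neg hi, add_zero]
    by_cases h2 : 2 ≤ i.val
    · rw [if_pos h2, if_pos h2]
    · rw [if_neg h2, if_neg h2, if_neg hz]

/-- `p₂ + (x₂ − y₂)e₂ = p₃`. [cite: Balaban1989LargeFieldI, p.196] -/
theorem base3_eq (l u x : Fin (n + 3) → ℤ) : P2 l u x + (x i1 - l i1) • e (i1 : Fin (n + 3)) = P3 u x := by
  funext i
  rw [Pi.add_apply, zsmul_e_apply, P2_apply, P3_apply]
  by_cases h1 : i.val = 1
  · have hi : i = i1 := (eq_i1_iff i).2 h1
    subst hi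
    rw [if_pos rfl, if_neg (by rw [i1_val]; omega), if_neg (by rw [i1_val]; omega), if_neg (by rw [i1_val]; omega)]
    ring
  · have hi : i ≠ i1 := fun h => h1 ((eq_i1_iff i).1 h)
    rw [if_neg hi, add_zero]
    by_cases h2 : 2 ≤ i.val
    · rw [if_pos h2, if_neg (by omega)]
    · have hz : i.val = 0 := by omega
      rw [if_neg h2, if_pos hz, if_pos hz]

/-- Coordinates along leg (b): `p₁ + t e₁`. [cite: Balaban1989LargeFieldI, p.196] -/
theorem legB_apply (l x : Fin (n + 3) → ℤ) (t : ℤ) (i : Fin (n + 3)) :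
    (P1 l x + t • e (i0 : Fin (n + 3))) i = if i.val = 0 then l i + t else P1 l x i := by
  rw [Pi.add_apply, zsmul_e_apply]
  by_cases hz : i.val = 0
  · have hi : i = i0 := (eq_i0_iff i).2 hz
    subst hi
    rw [if_pos rfl, if_pos hz, P1_apply, if_neg (by rw [i0_val]; omega)]
  · have hi : i ≠ i0 := fun h => hz ((eq_i0_iff i).1 h)
    rw [if_neg hi, if_neg hz, add_zero]

/-- Coordinates along leg (c): `p₂ + t e₂`. [cite: Balaban1989LargeFieldI, p.196] -/
theorem legC_apply (l u x : Fin (n + 3) → ℤ) (t : ℤ) (i : Fin (n + 3)) :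
    (P2 l u x + t • e (i1 : Fin (n + 3))) i = if i.val = 1 then l i + t else P2 l u x i := by
  rw [Pi.add_apply, zsmul_e_apply]
  by_cases h1 : i.val = 1
  · have hi : i = i1 := (eq_i1_iff i).2 h1
    subst hi
    rw [if_pos rfl, if_pos h1, P2_apply, if_neg (by rw [i1_val]; omega), if_neg (by rw [i1_val]; omega)]
  · have hi : i ≠ i1 := fun h => h1 ((eq_i1_iff i).1 h)
    rw [if_neg hi, if_neg h1, add_zero]

/-- Coordinates along leg (d): `p₃ − (t + 1) e₁`. [cite: Balaban1989LargeFieldI, p.196] -/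
theorem legD_apply (u x : Fin (n + 3) → ℤ) (t : ℤ) (i : Fin (n + 3)) :
    (P3 u x - (t + 1) • e (i0 : Fin (n + 3))) i = if i.val = 0 then u i - (t + 1) else x i := by
  rw [Pi.sub_apply, zsmul_e_apply, P3_apply]
  by_cases hz : i.val = 0
  · have hi : i = i0 := (eq_i0_iff i).2 hz
    subst hi
    rw [if_pos rfl, if_pos hz, if_pos hz]
  · have hi : i ≠ i0 := fun h => hz ((eq_i0_iff i).1 h)
    rw [if_neg hi, if_neg hz, if_neg hz, sub_zero]

/-- **THE DETOUR, BOTH READINGS AGREE**: for `y = l ≤ x ≤ u`, the unit bonds traversed by p26's detour word read from `l`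
are exactly r12's `detour l u x` (legs: high directions; `e₁` out to the far face; `e₂` on the far face; `e₁` back to `x`).
[cite: Balaban1989LargeFieldI, p.196] -/
theorem wordBonds_detour {l u x : Fin (n + 3) → ℤ} (hlx : l ≤ x) (hxu : x ≤ u) :
    wordBonds l (tw (highDirs n) (x - l) ++ detourTail l u x) = detour (n := n + 1) l u x := by
  have hv : ∀ κ ∈ highDirs n, 0 ≤ (x - l) κ := fun κ _ => by have := hlx κ; simp only [Pi.sub_apply]; linarith
  -- integer sizes of the three tail legs
  obtain ⟨A, hA⟩ := Int.eq_ofNat_of_zero_le (show 0 ≤ u i0 - l i0 by linarith [hlx i0, hxu i0])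
  obtain ⟨B, hB⟩ := Int.eq_ofNat_of_zero_le (show 0 ≤ x i1 - l i1 by linarith [hlx i1])
  obtain ⟨C, hC⟩ := Int.eq_ofNat_of_zero_le (show 0 ≤ u i0 - x i0 by linarith [hxu i0])
  have hC' : x i0 - u i0 = -(C : ℤ) := by linarith
  -- index bookkeeping: r12's literals `0, 1 : Fin (n + 1 + 2)` are p26's `i0, i1`
  have h00 : ((0 : Fin (n + 1 + 2)) : Fin (n + 3)) = i0 := Fin.ext (by rw [i0_val]; rfl)
  have h11 : ((1 : Fin (n + 1 + 2)) : Fin (n + 3)) = i1 := Fin.ext (by rw [i1_val]; rfl)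
  have hlt0 : ∀ i : Fin (n + 3), i0 < i ↔ ¬ i.val = 0 := fun i => by rw [Fin.lt_def, i0_val]; omega
  have hlt1 : ∀ i : Fin (n + 3), i1 < i ↔ 2 ≤ i.val := fun i => by rw [Fin.lt_def, i1_val]; omega
  ext ⟨w, κ⟩
  rw [detourTail, wordBonds_append, wordBonds_append, wordBonds_append, disp_tw highDirs_nodup, disp_append, disp_seg,
    disp_seg, ← add_assoc, base1_eq, base2_eq, base3_eq, hA, hB, hC', Finset.mem_union, Finset.mem_union, Finset.mem_union,
    mem_wordBonds_tw highDirs_pairwise hv, mem_wordBonds_seg_natCast, mem_wordBonds_seg_natCast, mem_wordBonds_seg_neg,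
    mem_detour, mem_box, h00, h11]
  dsimp only
  constructor
  · rintro (⟨μ, hμ, t, ht, hb⟩ | ((⟨t, ht, hb⟩ | ⟨t, ht, hb⟩) | ⟨t, ht, hb⟩))
    · -- (a) a high leg
      obtain ⟨hw, hκ⟩ := Prod.mk.inj hb
      subst hw; subst hκ
      rw [restrict_filter_highDirs hμ]
      have hμ2 := mem_highDirs.1 hμ
      have htμ : (t : ℤ) < x κ - l κ := by simpa only [Pi.sub_apply] using ht
      refine ⟨fun i => ?_, Or.inl ⟨hμ2, fun i hi => ?_, fun i hi => ?_, ?_⟩⟩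
      · rw [usualPt_apply]
        have h1 : l i ≤ x i := hlx i
        have h2 : x i ≤ u i := hxu i
        split_ifs with h3 h4
        · constructor <;> omega
        · subst h4; constructor <;> omega
        · constructor <;> omega
      · rw [usualPt_apply, if_neg (not_lt.2 hi.le), if_neg hi.ne]
      · rw [usualPt_apply, if_pos hi]
      · rw [usualPt_apply, if_neg (lt_irrefl κ), if_pos rfl]; omega
    · -- (b) the first leg of direction `e₁`
      obtain ⟨hw, hκ⟩ := Prod.mk.inj hb
      subst hw; subst hκ
      refine ⟨fun i => ?_, Or.inr (Or.inl ⟨rfl, ?_, fun i hi => ?_, ?_⟩)⟩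
      · rw [legB_apply, P1_apply]
        have h1 : l i ≤ x i := hlx i
        have h2 : x i ≤ u i := hxu i
        by_cases hz : i.val = 0
        · have hi : i = i0 := (eq_i0_iff i).2 hz
          subst hi
          rw [if_pos hz]; constructor <;> omega
        · rw [if_neg hz]; split_ifs <;> constructor <;> omega
      · rw [legB_apply, if_neg (by rw [i1_val]; omega), P1_apply, if_neg (by rw [i1_val]; omega)]
      · rw [legB_apply, if_neg (by rw [hlt1] at hi; omega), P1_apply, if_pos ((hlt1 i).1 hi)]
      · rw [legB_apply, if_pos i0_val]; omega
    · -- (c) the leg of direction `e₂` on the far face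
      obtain ⟨hw, hκ⟩ := Prod.mk.inj hb
      subst hw; subst hκ
      refine ⟨fun i => ?_, Or.inr (Or.inr (Or.inl ⟨rfl, ?_, fun i hi => ?_, ?_⟩))⟩
      · rw [legC_apply, P2_apply]
        have h1 : l i ≤ x i := hlx i
        have h2 : x i ≤ u i := hxu i
        by_cases hone : i.val = 1
        · have hi : i = i1 := (eq_i1_iff i).2 hone
          subst hi
          rw [if_pos hone]; constructor <;> omega
        · rw [if_neg hone]; split_ifs <;> constructor <;> omega
      · rw [legC_apply, if_neg (by rw [i0_val]; omega), P2_apply, if_neg (by rw [i0_val]; omega), if_pos i0_val]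
      · rw [legC_apply, if_neg (by rw [hlt1] at hi; omega), P2_apply, if_pos ((hlt1 i).1 hi)]
      · rw [legC_apply, if_pos i1_val]; omega
    · -- (d) the return leg of direction `e₁`
      obtain ⟨hw, hκ⟩ := Prod.mk.inj hb
      subst hw; subst hκ
      refine ⟨fun i => ?_, Or.inr (Or.inr (Or.inr ⟨rfl, fun i hi => ?_, ?_, ?_⟩))⟩
      · rw [legD_apply]
        have h1 : l i ≤ x i := hlx i
        have h2 : x i ≤ u i := hxu i
        have h3 : l i0 ≤ x i0 := hlx i0
        by_cases hz : i.val = 0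
        · have hi : i = i0 := (eq_i0_iff i).2 hz
          subst hi
          rw [if_pos hz]; constructor <;> omega
        · rw [if_neg hz]; constructor <;> omega
      · rw [legD_apply, if_neg ((hlt0 i).1 hi)]
      · rw [legD_apply, if_pos i0_val]; omega
      · rw [legD_apply, if_pos i0_val]; omega
  · rintro ⟨hbox, hcl⟩
    rcases hcl with ⟨h2, hlow, hhigh, hlt⟩ | ⟨rfl, hw1, hhigh, hlt⟩ | ⟨rfl, hw0, hhigh, hlt⟩ | ⟨rfl, hhigh, hle, hlt⟩
    · -- (a)
      have hlκ : l κ ≤ w κ := (hbox κ).1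
      obtain ⟨t, ht⟩ := Int.eq_ofNat_of_zero_le (sub_nonneg.2 hlκ)
      refine Or.inl ⟨κ, mem_highDirs.2 h2, t, ?_, ?_⟩
      · simp only [Pi.sub_apply]; omega
      · rw [restrict_filter_highDirs (mem_highDirs.2 h2)]
        refine Prod.ext (funext fun i => ?_) rfl
        show w i = (l + hiPart κ (x - l) + (t : ℤ) • e κ) i
        rw [usualPt_apply]
        split_ifs with h1 h3
        · exact hhigh i h1
        · subst h3; omega
        · exact hlow i (lt_of_le_of_ne (not_lt.1 h1) h3)
    · -- (b)
      have hl0 : l i0 ≤ w i0 := (hbox i0).1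
      obtain ⟨t, ht⟩ := Int.eq_ofNat_of_zero_le (sub_nonneg.2 hl0)
      refine Or.inr (Or.inl (Or.inl ⟨t, by omega, Prod.ext (funext fun i => ?_) rfl⟩))
      show w i = (P1 l x + (t : ℤ) • e (i0 : Fin (n + 3))) i
      rw [legB_apply, P1_apply]
      by_cases hz : i.val = 0
      · have hi : i = i0 := (eq_i0_iff i).2 hz
        subst hi
        rw [if_pos hz]; omega
      · rw [if_neg hz]
        by_cases h2' : 2 ≤ i.val
        · rw [if_pos h2']; exact hhigh i ((hlt1 i).2 h2')
        · rw [if_neg h2']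
          have hi : i = i1 := (eq_i1_iff i).2 (by omega)
          subst hi
          exact hw1
    · -- (c)
      have hl1 : l i1 ≤ w i1 := (hbox i1).1
      obtain ⟨t, ht⟩ := Int.eq_ofNat_of_zero_le (sub_nonneg.2 hl1)
      refine Or.inr (Or.inl (Or.inr ⟨t, by omega, Prod.ext (funext fun i => ?_) rfl⟩))
      show w i = (P2 l u x + (t : ℤ) • e (i1 : Fin (n + 3))) i
      rw [legC_apply, P2_apply]
      by_cases hone : i.val = 1
      · have hi : i = i1 := (eq_i1_iff i).2 hone
        subst hi
        rw [if_pos hone]; omega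
      · rw [if_neg hone]
        by_cases h2' : 2 ≤ i.val
        · rw [if_pos h2']; exact hhigh i ((hlt1 i).2 h2')
        · have hz : i.val = 0 := by omega
          rw [if_neg h2', if_pos hz]
          have hi : i = i0 := (eq_i0_iff i).2 hz
          subst hi
          exact hw0
    · -- (d)
      obtain ⟨t, ht⟩ := Int.eq_ofNat_of_zero_le (show 0 ≤ u i0 - w i0 - 1 by omega)
      refine Or.inr (Or.inr ⟨t, by omega, Prod.ext (funext fun i => ?_) rfl⟩)
      show w i = (P3 u x - ((t : ℤ) + 1) • e (i0 : Fin (n + 3))) i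
      rw [legD_apply]
      by_cases hz : i.val = 0
      · have hi : i = i0 := (eq_i0_iff i).2 hz
        subst hi
        rw [if_pos hz]; omega
      · rw [if_neg hz]; exact hhigh i ((hlt0 i).2 hz)

end DetourBridge

/-! ## §4  The contour and the tree -/

section ContourBridge

variable {n : ℕ}

/-- **THE DICTIONARY** (row `B15.Def@196`): for a lattice point `x` of the box `P₁` (`lo ≤ x ≤ hi`), the unit bonds
traversed by p26's word `Γ_{y,x} = B15TreeGauge196.contour lo hi τ x` read from the corner `y = lo` form exactly r12's
bond set `B15TreeGraph196.contour lo hi τ x` — same threshold `a ↦ τ`, same far face `b₁ − 1/2 ↦ hi i0`.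
[cite: Balaban1989LargeFieldI, p.196] -/
theorem wordBonds_contour {lo hi x : Fin (n + 3) → ℤ} (hlx : lo ≤ x) (hxu : x ≤ hi) (τ : ℤ) :
    wordBonds lo (B15TreeGauge196.contour lo hi τ x) = B15TreeGraph196.contour (n := n + 1) lo hi τ x := by
  have h00 : ((0 : Fin (n + 1 + 2)) : Fin (n + 3)) = i0 := Fin.ext (by rw [i0_val]; rfl)
  unfold B15TreeGraph196.contour
  rw [h00]
  by_cases h : x i0 ≤ τ
  · rw [contour_of_le h, if_pos h, wordBonds_treeWord hlx]
  · rw [contour_of_not_le h, if_neg h, wordBonds_detour hlx hxu]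

/-- **THE TREE**: the union over the points `x ∈ P₁∖P₂` of the bonds traversed by p26's words `Γ_{y,x}` is r12's tree
`T = ⋃_{x∈P₁∖P₂} Γ_{y,x}` (`B15TreeGraph196.tree`) — so *"the union of all the contours is a tree graph T on P₁∖P₂"*
(`B15TreeGraph196.tree_isTree`, `card_tree`, under `Adm`) holds for the word reading too. [cite: Balaban1989LargeFieldI, p.196] -/
theorem biUnion_wordBonds_contour (lo hi lo' hi' : Fin (n + 3) → ℤ) (τ : ℤ) :
    (B15TreeGraph196.ann (n := n + 1) lo hi lo' hi').biUnion (fun x => wordBonds lo (B15TreeGauge196.contour lo hi τ x)) =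
      B15TreeGraph196.tree (n := n + 1) lo hi lo' hi' τ := by
  unfold B15TreeGraph196.tree
  refine Finset.biUnion_congr rfl fun x hx => ?_
  have hxbox := (B15TreeGraph196.mem_box.1 (B15TreeGraph196.mem_ann.1 hx).1)
  exact wordBonds_contour (fun i => (hxbox i).1) (fun i => (hxbox i).2) τ

/-- Hence, under r12's separation hypotheses `Adm`, the graph on `P₁∖P₂` whose edges are the bonds traversed by p26's
contours IS A TREE with `|T| + 1 = |P₁∖P₂|` (*"we fix … all gauge degrees of freedom connected with the set P₁∖P₂,
except one"*). [cite: Balaban1989LargeFieldI, p.196] -/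
theorem wordContours_isTree {lo hi lo' hi' : Fin (n + 3) → ℤ} {τ : ℤ} (h : B15TreeGraph196.Adm (n := n + 1) lo hi lo' hi' τ) :
    (B15TreeGraph196.bondGraph
        ((B15TreeGraph196.ann (n := n + 1) lo hi lo' hi').biUnion fun x => wordBonds lo (B15TreeGauge196.contour lo hi τ x))
        (B15TreeGraph196.ann (n := n + 1) lo hi lo' hi')).IsTree ∧
      ((B15TreeGraph196.ann (n := n + 1) lo hi lo' hi').biUnion
          fun x => wordBonds lo (B15TreeGauge196.contour lo hi τ x)).card + 1 =
        (B15TreeGraph196.ann (n := n + 1) lo hi lo' hi').card := by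
  rw [biUnion_wordBonds_contour]
  exact ⟨B15TreeGraph196.tree_isTree h, B15TreeGraph196.card_tree h⟩

end ContourBridge

end Literature.MathematicalPhysics.QuantumFieldTheory.Balaban1983to89.B15TreeGauge196Bridge
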